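import Summits.Langlands.Langlands.Theorems.IrreducibilityBySelfDualityWeakAbelianSummandHecke
import Summits.Langlands.Langlands.Theorems.IrreducibilityBySelfDualityGaloisRepOfRegularAlgebraicAEIrreducible
import Summits.Langlands.Langlands.Theorems.IrreducibilityBySelfDualityGaloisRepOfRegularAlgebraic
import HarnessLib

/-!
# Restatement kit (lead c5, crux stmt-Langlands-10785): route `IrreducibilityBySelfDuality` closes with
# `GaloisRepGL2CMae` in place of `GaloisRepOfRegularAlgebraic`

EVIDENCE for the planner (a crux workfile, not a proposal target: it imports the route module).  It
re-elaborates the route's deciding chain with the crux `GaloisRepOfRegularAlgebraic` (lang.S27 verbatim: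
every `n`, TR ∨ CM, every unramified `v ∤ ℓ`, semisimple) replaced by the weaker `GaloisRepGL2CMae`
(`GL₂` over CM fields, almost everywhere, no semisimplicity), using only landed theorems:

* `EssSelfDualIrreducibleCMae` / `essSelfDualIrreducibleCMae_proof` — item 13618 restated (first
  antecedent := `GaloisRepGL2CMae`), same proof as the landed `essSelfDualIrreducibleCM_of_gl2CM_ae` (p124798), through `isIrreducible_of_compatible_ae` (p124540);
* `IrreducibleGL3CMae` / `irreducibleGL3CMae_proof` — item 14068 restated, proof = `frame_proof`'s body
  verbatim (its three landed stub modules), fed with the restated 13618;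
* `Assemblyae` / `assemblyae_proof` — item 14093 restated, proof = the landed assembly's body verbatim;
* `closesae` — the deciding theorem with `(i2 : GaloisRepGL2CMae)`: the other seven hypotheses are the
  route's remaining cruxes/inputs BY NAME, unchanged; `WeakAbelianSummandHecke` and
  `ReducibleForcesEssSelfDual` enter through their landed proofs.

So restating stmt-Langlands-10785 (for this route) as `GaloisRepGL2CMae` costs three text restatements
(13618, 14068, 14093) whose proofs are in this file, and removes Varma 2024 (`prop71_twoN`, item 15004)
and every rank `n ≥ 3` from the route's cone; `GaloisRepGL2CMae` itself is `theoremA_existence` at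
`n = 2` over CM (`gl2CM_ae_of_theoremA_existence`, p124798) and is implied by the crux as filed
(`gl2CM_ae_of_item`).  `lean check`: rc 0, sorry-free.
-/

noncomputable section

set_option linter.dupNamespace false -- project-wide option (lakefile weak.linter.dupNamespace); `Summit.Langlands.Langlands` is the mandated namespace

-- the `open` lines of the route file, so that the inlined bodies elaborate to the same terms
open scoped BigOperators Topology Manifold Classical MeasureTheory ProbabilityTheory Matrix InnerProductSpace ComplexConjugate ContinuousMap
open Filter Set Function TopologicalSpace MeasureTheory
open scoped NumberField
open IsDedekindDomain
open Literature.NumberTheory.Automorphic Literature.NumberTheory.GaloisRepresentations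
open Summit.Langlands.Langlands.Theses.IrreducibilityBySelfDuality
open Summit.Langlands.Langlands.Theorems.IrreducibleGL3CM

namespace Summit.Langlands.Langlands.Theorems.GaloisRepOfRegularAlgebraic.RestateKit

/-- **Proposed restated crux** (`GL₂/CM/a.e.`): for `K` CM, `σ` regular algebraic cuspidal on
`GL₂(𝔸_K)`, `ℓ`, `ι`, some continuous `ρ : Γ_K → GL₂(ℚ̄_ℓ)` unramified and Satake–Frobenius compatible
with `σ` (C-normalisation `arithFrobPolyOfSatake ι q_v 2 β`) at all but finitely many `v`.  Harris–Lan–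
Taylor–Thorne 2016 Thm. A at `n = 2` (`gl2CM_ae_of_theoremA_existence`).
[cite: HarrisLanTaylorThorneRMS2016, Thm. A (p. 3)] -/
def GaloisRepGL2CMae : Prop :=
  ∀ (K : Type) [Field K] [NumberField K]
    (hcpt₂ : Literature.NumberTheory.Automorphic.isCompact_glFiniteIntegralLevel 2 K),
    NumberField.IsCMField K →
    ∀ (σ : Literature.NumberTheory.Automorphic.CuspidalAutomorphicRepData 2 K hcpt₂),
    σ.1.IsRegularAlgebraic → ∀ (ℓ : ℕ) [Fact ℓ.Prime] (ι : PadicAlgCl ℓ ≃+* ℂ),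
    ∃ ρ : Literature.NumberTheory.GaloisRepresentations.FramedGaloisRep K (PadicAlgCl ℓ) 2,
      ∀ᶠ v : IsDedekindDomain.HeightOneSpectrum (NumberField.RingOfIntegers K) in Filter.cofinite,
        ∀ β : Multiset ℂ, σ.1.HasSatakeParamAt v β →
          ρ.IsUnramifiedAt v ∧ ρ.HasFrobCharpolyAt v
            (Literature.NumberTheory.Automorphic.arithFrobPolyOfSatake ι v.residueCard 2 β)

/-- The crux as filed implies the proposed restatement (specialise `n = 2`, forget semisimplicity,
discard the finitely many places over `ℓ`; the landed `gl2CM_ae_of_item`, re-proved here so that the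
kit depends only on already-built modules). [folklore] -/
theorem galoisRepGL2CMae_of_crux (h : GaloisRepOfRegularAlgebraic) : GaloisRepGL2CMae := by
  intro K _ _ hcpt₂ hCM σ hσ ℓ _ ι
  obtain ⟨ρ, -, hρ⟩ := h 2 K hcpt₂ (Or.inr hCM) σ hσ ℓ ι
  refine ⟨ρ, ?_⟩
  filter_upwards [FramedGaloisRep.eventually_natCast_not_mem K ℓ] with v hℓ β hβ
  exact hρ v β hβ hℓ

/-- Item `EssSelfDualIrreducibleCM` (13618) with its first antecedent restated to `GaloisRepGL2CMae`
(the other two antecedents and the conclusion verbatim, `RegularAdjointLiftCM` by name as in the route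
file). [folklore] -/
def EssSelfDualIrreducibleCMae : Prop :=
  GaloisRepGL2CMae → SelfdualGL3AdjointLift → RegularAdjointLiftCM → ∀ (K : Type) [Field K] [NumberField K], NumberField.IsCMField K → ∀ (h1 : _) (hcpt : _) (π : Literature.NumberTheory.Automorphic.CuspidalAutomorphicRepData 3 K hcpt), π.1.IsRegularAlgebraic → (∃ η : Literature.NumberTheory.Automorphic.CuspidalAutomorphicRepData 1 K h1, ∀ᶠ v in cofinite, ∀ α : Multiset ℂ, π.1.HasSatakeParamAt v α → ∃ e : ℂ, η.1.HasSatakeParamAt v {e} ∧ α.map (fun a => a⁻¹) = α.map (fun a => e * a)) → ∀ (ℓ : ℕ) [Fact ℓ.Prime] (ι : PadicAlgCl ℓ ≃+* ℂ) (r : Literature.NumberTheory.GaloisRepresentations.FramedGaloisRep K (PadicAlgCl ℓ) 3), r.toGaloisRep.IsSemisimple → (∀ᶠ v in cofinite, ∀ α : Multiset ℂ, π.1.HasSatakeParamAt v α → r.IsUnramifiedAt v ∧ r.HasFrobCharpolyAt v (Literature.NumberTheory.Automorphic.arithFrobPolyOfSatake ι v.residueCard 3 α)) → ¬ (∃ x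 : Fin 3 → (Fin 3 → PadicAlgCl ℓ), LinearIndependent (PadicAlgCl ℓ) x ∧ ∀ (i : Fin 3) (g : Field.absoluteGaloisGroup K), ∃ c : PadicAlgCl ℓ, r.toGaloisRep g (x i) = c • x i) → r.toGaloisRep.IsIrreducible

/-- The restated 13618 holds (same proof as the landed `essSelfDualIrreducibleCM_of_gl2CM_ae`, p124798,
written against the by-name text so that the kit depends only on already-built modules):
`RegularAdjointLiftCM` gives `(σ, ν)`, the restated crux gives `ρ₁` (a.e.), the tree's THEOREM
`rank_one` (Weil 1956) gives `ψ`, and `isIrreducible_of_compatible_ae` (p124540) concludes. [folklore] -/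
theorem essSelfDualIrreducibleCMae_proof : EssSelfDualIrreducibleCMae := by
  intro hGR hSD hRAL K _ _ hCM h1 hcpt π hRA hess ℓ _ ι r hrss hr h3
  have hcpt₂ : Literature.NumberTheory.Automorphic.isCompact_glFiniteIntegralLevel 2 K :=
    isCompact_glFiniteIntegralLevel_holds 2 K
  obtain ⟨σ, ν, hσRA, hνRA, hnd, hAd⟩ := hRAL hSD K hCM h1 hcpt₂ hcpt π hRA hess
  obtain ⟨ρ₁, hρ₁⟩ := hGR K hcpt₂ hCM σ hσRA ℓ ι
  obtain ⟨ψ, -, hψ⟩ := rank_one K h1 ν hνRA ℓ ι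
  have hψ' : ∀ᶠ v : HeightOneSpectrum (𝓞 K) in cofinite, ∀ γ : Multiset ℂ, ν.1.HasSatakeParamAt v γ →
      ψ.IsUnramifiedAt v ∧ ψ.HasFrobCharpolyAt v (arithFrobPolyOfSatake ι v.residueCard 1 γ) := by
    filter_upwards [FramedGaloisRep.eventually_natCast_not_mem K ℓ] with v hℓ γ hγ
    exact hψ v γ hγ hℓ
  exact isIrreducible_of_compatible_ae ι π σ ν hnd hAd ρ₁ hρ₁ ψ hψ' r hrss hr h3

/-- Item `IrreducibleGL3CM` (14068) restated: the by-name implication of the route file with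
`EssSelfDualIrreducibleCM`, `GaloisRepOfRegularAlgebraic` replaced by their `ae` restatements.
[folklore] -/
def IrreducibleGL3CMae : Prop :=
  RegularAdjointLiftCM → EssSelfDualIrreducibleCMae → ReducibleForcesEssSelfDual → GaloisRepGL2CMae → WeakAbelianSummandHecke → SelfdualGL3AdjointLift → PairLBoundaryJS → ContragredientDatum → HeckeEigenvalueField → ∀ (K : Type) [Field K] [NumberField K], NumberField.IsCMField K → ∀ (hcpt : Literature.NumberTheory.Automorphic.isCompact_glFiniteIntegralLevel 3 K) (π : Literature.NumberTheory.Automorphic.CuspidalAutomorphicRepData 3 K hcpt), π.1.IsLAlgebraic → (∃ T : Literature.NumberTheory.Automorphic.InfinityType K 3, π.1.HasInfinityType T ∧ T.IsRegular) → ∀ (ℓ : ℕ) [Fact ℓ.Prime] (ι : PadicAlgCl ℓ ≃+* ℂ) (ρ : Literature.NumberTheory.GaloisRepresentations.FramedGaloisRep K (PadicAlgCl ℓ) 3), (∀ᶠ v : IsDedekindDomain.HeightOneSpectrum (NumberField.RingOfIntegers K) in cofinite, ∃ α : Multiset ℂ, π.1.HasSatakeParamAt v α ∧ ρ.IsUnramifiedAt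 v ∧ ρ.HasFrobCharpolyAt v (Literature.NumberTheory.Automorphic.arithFrobPolyOfSatake ι v.residueCard 1 α)) → ρ.toGaloisRep.IsIrreducible

/-- The restated 14068 holds — `IrreducibleGL3CM.frame_proof`'s body verbatim (regular algebraicity
from odd rank, cyclotomic untwist, continuous semisimplification, Brauer–Nesbitt, dispatch to
`ReducibleForcesEssSelfDual` and the restated `EssSelfDualIrreducibleCM`). [folklore] -/
theorem irreducibleGL3CMae_proof : IrreducibleGL3CMae := by
  intro hRAL hES hRF hGR hWA hSD hPL hCD hHE K _ _ hCM hcpt π hL hT ℓ _ ι ρ h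
  -- (i) regular algebraicity: `n = 3` is odd, so an L-algebraic infinity type `T₁` of `π` is C-algebraic
  -- (`InfinityType.isCAlgebraic_iff_isLAlgebraic_of_odd`), and it is regular because regularity only reads
  -- the `a`-multisets, which agree for all infinity types of `π` (`HasInfinityType.map_a_eq`)
  have hRA : π.1.IsRegularAlgebraic := by
    obtain ⟨T₁, hT₁, hL₁⟩ := hL
    obtain ⟨T₂, hT₂, hR₂⟩ := hT
    refine ⟨T₁, hT₁, ?_, fun σ => ?_⟩
    · exact (InfinityType.isCAlgebraic_iff_isLAlgebraic_of_odd (by decide : Odd 3) T₁).mpr hL₁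
    · rw [AutomorphicRepData.HasInfinityType.map_a_eq π.1 hT₁ hT₂ σ]
      exact hR₂ σ
  -- (ii) the cyclotomic untwist, compatible a.e. in the `m = 3` normalisation
  obtain ⟨ρ', himp, hρ'v⟩ := stub_cyclotomicUntwist K ℓ ι ρ
  have hρ' : ∀ᶠ v : HeightOneSpectrum (𝓞 K) in cofinite, ∀ α : Multiset ℂ, π.1.HasSatakeParamAt v α →
      ρ'.IsUnramifiedAt v ∧ ρ'.HasFrobCharpolyAt v (arithFrobPolyOfSatake ι v.residueCard 3 α) := by
    filter_upwards [h, FramedGaloisRep.eventually_natCast_not_mem K ℓ] with v hv hℓ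
    obtain ⟨α₀, hα₀, hur, hcp⟩ := hv
    intro α hα
    obtain rfl : α = α₀ := AutomorphicRepData.hasSatakeParamAt_unique_holds π.1 hα hα₀
    obtain ⟨hur', hcp'⟩ := hρ'v v hℓ hur
    exact ⟨hur', hcp' α hcp⟩
  -- (iii) the continuous semisimplification, still compatible a.e.
  obtain ⟨r, hrss, hrcp, hrker⟩ := stub_continuousSemisimplification K ℓ 3 ρ'
  have hr : ∀ᶠ v : HeightOneSpectrum (𝓞 K) in cofinite, ∀ α : Multiset ℂ, π.1.HasSatakeParamAt v α →
      r.IsUnramifiedAt v ∧ r.HasFrobCharpolyAt v (arithFrobPolyOfSatake ι v.residueCard 3 α) := by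
    filter_upwards [hρ'] with v hv α hα
    obtain ⟨hur, hcp⟩ := hv α hα
    exact ⟨fun 𝔓 h𝔓 σ hσ => hrker σ (hur 𝔓 h𝔓 σ hσ),
      fun 𝔓 h𝔓 σ hσ => (hrcp σ).trans (hcp 𝔓 h𝔓 σ hσ)⟩
  -- (iv) dispatch
  by_contra hirr
  have hρ'irr : ¬ ρ'.toGaloisRep.IsIrreducible := fun h' => hirr (himp h')
  have hrirr : ¬ r.toGaloisRep.IsIrreducible :=
    stub_not_isIrreducible_of_charpoly_eq K ℓ 3 ρ' r hrss hrcp hρ'irr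
  have h1 : isCompact_glFiniteIntegralLevel 1 K := isCompact_glFiniteIntegralLevel_holds 1 K
  obtain ⟨hess, h3⟩ := hRF hWA hHE hPL hCD K h1 hcpt π hRA ℓ ι r hrss hr
  exact hrirr (hES hGR hSD hRAL K hCM h1 hcpt π hRA (hess hrirr) ℓ ι r hrss hr h3)

/-- Item `Assembly` (14093) restated: the twelve-fold conjunction with (2), (5), (7) replaced by their
`ae` restatements implies the summit statement. [folklore] -/
def Assemblyae : Prop :=
  ReciprocityUpToIrreducibility ∧ IrreducibleGL3CMae ∧ IrreducibleOffSector ∧ RegularAdjointLiftCM ∧ EssSelfDualIrreducibleCMae ∧ ReducibleForcesEssSelfDual ∧ GaloisRepGL2CMae ∧ WeakAbelianSummandHecke ∧ SelfdualGL3AdjointLift ∧ PairLBoundaryJS ∧ ContragredientDatum ∧ HeckeEigenvalueField → _root_.Langlands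

/-- The restated assembly holds — the landed `irreducibilityBySelfDuality_assembly`'s body verbatim
(sector dispatch + Chebotarev–Brauer–Nesbitt uniqueness). [folklore] -/
theorem assemblyae_proof : Assemblyae := by
  rintro ⟨hE, hT, hO, c2, c3, c4, i2, i1, i3, i4, i5, i6⟩
  intro F _ _
  obtain ⟨Rec, hRec⟩ := hE F
  refine ⟨Rec, fun n hn hcpt => ?_⟩
  obtain ⟨hA, hB⟩ := hRec n hn hcpt
  refine ⟨?_, hB⟩
  intro π hL ℓ _ ι
  -- irreducibility of EVERY avatar Satake–Frobenius compatible a.e. with `π`: sector dispatch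
  -- (in the sector n = 3, K CM, regular infinity type: (2) `IrreducibleGL3CM` fed with the three
  -- cruxes and six inputs; off the sector: (3) `IrreducibleOffSector`)
  have irr : ∀ ρ : Literature.NumberTheory.GaloisRepresentations.FramedGaloisRep F (PadicAlgCl ℓ) n,
      (∀ᶠ v : IsDedekindDomain.HeightOneSpectrum (NumberField.RingOfIntegers F) in Filter.cofinite,
        SatakeFrobCompatibleAt ι π.1 ρ v) → ρ.toGaloisRep.IsIrreducible := by
    intro ρ hρ
    by_cases hs : (n = 3 ∧ NumberField.IsCMField F ∧
        ∃ T : Literature.NumberTheory.Automorphic.InfinityType F n,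
          π.1.HasInfinityType T ∧ T.IsRegular)
    · obtain ⟨rfl, hCM, hT'⟩ := hs
      exact hT c2 c3 c4 i2 i1 i3 i4 i5 i6 F hCM hcpt π hL hT' ℓ ι ρ hρ
    · exact hO n F hcpt hn π hL hs ℓ ι ρ hρ
  obtain ⟨ρ, hgeo, hcorr⟩ := hA π hL ℓ ι
  refine ⟨ρ, irr ρ hcorr.1, hgeo, hcorr, fun ρ' hcorr' => ?_⟩
  -- uniqueness up to conjugacy: irreducible ⇒ semisimple; equal Satake parameters a.e. (Flath)
  -- ⇒ equal Frobenius polynomials a.e. ⇒ equivalent (Chebotarev + Brauer–Nesbitt) ⇒ conjugate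
  have h1 : ρ.toGaloisRep.IsIrreducible := irr ρ hcorr.1
  have h2 : ρ'.toGaloisRep.IsIrreducible := irr ρ' hcorr'.1
  have hs1 : ρ.toGaloisRep.IsSemisimple := by
    haveI := h1
    change ComplementedLattice _
    infer_instance
  have hs2 : ρ'.toGaloisRep.IsSemisimple := by
    haveI := h2
    change ComplementedLattice _
    infer_instance
  have hev : ∀ᶠ v : IsDedekindDomain.HeightOneSpectrum (NumberField.RingOfIntegers F) in Filter.cofinite,
      ρ.IsUnramifiedAt v ∧ ρ'.IsUnramifiedAt v ∧
        ∃ P : Polynomial (PadicAlgCl ℓ), ρ.HasFrobCharpolyAt v P ∧ ρ'.HasFrobCharpolyAt v P := by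
    filter_upwards [hcorr.1, hcorr'.1] with v hv hv'
    obtain ⟨α, hα, hur, hcp⟩ := hv
    obtain ⟨α', hα', hur', hcp'⟩ := hv'
    obtain rfl : α = α' :=
      Literature.NumberTheory.Automorphic.AutomorphicRepData.hasSatakeParamAt_unique_holds π.1 hα hα'
    exact ⟨hur, hur', _, hcp, hcp'⟩
  obtain ⟨e⟩ :=
    Literature.NumberTheory.GaloisRepresentations.FramedGaloisRep.nonempty_equiv_of_hasFrobCharpolyAt_eventually
      Literature.NumberTheory.Automorphic.chebotarev_artinRep_holds ρ ρ' hs1 hs2 hev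
  obtain ⟨P, hP⟩ :=
    Literature.NumberTheory.GaloisRepresentations.FramedRep.exists_eq_conj_of_equiv ρ ρ' e
  exact ⟨P, hP.symm⟩

/-- **The deciding theorem with the restated crux.**  Hypotheses: the route's cruxes / printed inputs
BY NAME exactly as in `closes`, except `i2 : GaloisRepGL2CMae`; `WeakAbelianSummandHecke` (13620) and
`ReducibleForcesEssSelfDual` (13619) enter through their landed proofs. [folklore] -/
theorem closesae (c2 : RegularAdjointLiftCM) (i2 : GaloisRepGL2CMae) (i3 : SelfdualGL3AdjointLift)
    (i4 : PairLBoundaryJS) (i5 : ContragredientDatum) (i6 : HeckeEigenvalueField)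
    (cO : IrreducibleOffSector) (cE : ReciprocityUpToIrreducibility) : _root_.Langlands :=
  assemblyae_proof ⟨cE, irreducibleGL3CMae_proof, cO, c2, essSelfDualIrreducibleCMae_proof,
    ReducibleForcesEssSelfDual_holds, i2, WeakAbelianSummandHecke_proof, i3, i4, i5, i6⟩

/-- Sanity link: the deciding theorem as it stands today follows from `closesae` and the crux as filed.
[folklore] -/
theorem closes_of_closesae (c2 : RegularAdjointLiftCM) (i2 : GaloisRepOfRegularAlgebraic)
    (i3 : SelfdualGL3AdjointLift) (i4 : PairLBoundaryJS) (i5 : ContragredientDatum)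
    (i6 : HeckeEigenvalueField) (cO : IrreducibleOffSector) (cE : ReciprocityUpToIrreducibility) :
    _root_.Langlands :=
  closesae c2 (galoisRepGL2CMae_of_crux i2) i3 i4 i5 i6 cO cE

end Summit.Langlands.Langlands.Theorems.GaloisRepOfRegularAlgebraic.RestateKit

end
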